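import Literature.NumberTheory.Automorphic.AutomorphicInductionCharacterCyclicReduction
import Literature.NumberTheory.Automorphic.AutomorphicInductionCuspidal
import Literature.NumberTheory.Automorphic.HenniartAutomorphicInduction
import Literature.NumberTheory.Automorphic.InfinityTypeAutomorphicInduction
import Literature.NumberTheory.Automorphic.GLOneArchParameterOfAlgebraicCharacter
import Literature.NumberTheory.Automorphic.AutomorphicInductionUnitaryCharacterCubicArchimedeanProofs
import HarnessLib

/-!
# Stub `stub_cmInducedCuspidal` of the line `top-degree-exact-control` (crux
# `SkinnerWilesDefectOne.ProModularOrdinaryClassical`, stmt-Langlands-12921): cuspidal automorphic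
# induction of a regular algebraic Hecke character through a quadratic extension, L-algebraic

Registered stub of the checked skeleton `Cruxes/ProModularOrdinaryClassical/Lines/top-degree-exact-control.lean`
(rev 6), CM regime, automorphic side.  For a number field `F`, a quadratic extension `K/F` and an ALGEBRAIC
Hecke character `θ` of `K` with `θ(ϖ_{w'}) ≠ θ(ϖ_w)` for infinitely many pairs `w, w'` of places of `K` over
one place of `F`, there is a CUSPIDAL `π` on `GL₂(𝔸_F)` which is L-algebraic and has at almost every finite
place `v` of `F` a Satake parameter `α` with `∏_{a ∈ α} (X - a) = ∏_{w ∣ v} (X^{f(w|v)} - θ(ϖ_w))`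
(Arthur–Clozel's (6.1)–(6.2)), MODULO the three printed facts prepended as hypotheses:
(A) `automorphicInduction_cyclic_cuspidal` (Arthur–Clozel 1989, Ch. 3, Thm. 6.2 with Lemma 6.4),
(B) `Henniart2012_infinityType_of_automorphicInduction` (Henniart 2012: the archimedean `z`-exponents of
an automorphic induction are the sums over the embeddings above `σ`), (C) existence of an infinity type
for every automorphic representation datum (`AutomorphicRepData.exists_hasInfinityType`, Clozel 1990 §3.3).

Proof (everything else is proved in the tree):

1. `K/F` quadratic ⇒ Galois with cyclic group of prime order `2` (Mathlib
   `Algebra.IsQuadraticExtension.isGalois/isCyclic`).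
2. The datum `π_θ` of `GL₁(𝔸_K)` (`exists_automorphicRepData_hasSatakeParamAt_valueAtUniformizer`: Satake
   parameter `{θ(ϖ_w)}` at almost every `w`) is cuspidal (`AutomorphicRepData.W_le_cuspFormsGL_one`) and
   not Galois-stable in the Satake sense (`not_isGaloisStableSatakeAE_of_frequently_ne`, from the regularity
   hypothesis); fact (A) at `n = 1` gives a cuspidal `P` on `GL_{1·[K:F]}(𝔸_F)` automorphically induced from
   `π_θ` (`IsAutomorphicInductionAlong`), transported to rank `2` along `1 · [K:F] = 2`
   (`exists_cuspidal_along_of_eq`, a `subst`).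
3. Satake clause: Def. 6.1 for `n = 1` is the character identity
   (`isAutomorphicInductionAlong_iff_of_hasSatakeParamAt_singleton`).
4. L-algebraicity: `θ` algebraic ⇒ `θ` has an infinity type `(p, q)`
   (`HeckeCharacter.isAlgebraic_iff_exists_hasInfinityType`); `π_θ` has Hecke character `θ`
   (`AutomorphicRepData.heckeCharacter_of_eventually_hasSatakeParamAt_glOne`), hence the infinity type
   `ι ↦ {(-n_ι, -n_ῑ)}` (`exists_hasInfinityType_of_hasInfinityType_heckeCharacter_glOne`), which is
   L-algebraic (`isLAlgebraic_of_map_a_eq_singleton`: integral `a`, and `a - b ∈ ℤ`); `P` has SOME infinity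
   type by fact (C), so by fact (B) read on induced infinity types
   (`Henniart2012_infinityType_of_automorphicInduction.hasInfinityType_automorphicInduction`) `P` has the
   induced infinity type `T_θ^{K/F}`, which is L-algebraic (`InfinityType.IsLAlgebraic.automorphicInduction`).

Declared in the skeleton's namespace `Summit.Langlands.Langlands.Cruxes.ProModularOrdinaryClassical.TopDegreeExactControl`
so that the landed theorem reads byte-identically to its registration.
References: [ArthurClozelAMS120] Ch. 3 Def. 6.1, Thm. 6.2, Lemma 6.4; [Henniart2012] §1.10, Thm. 3 (i), Thm. 5,
Remarque §3.7; [Clozel1990] §3.3; [BuzzardGee2014] Def. 3.1.1.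
-/

noncomputable section

namespace Summit.Langlands.Langlands.Cruxes.ProModularOrdinaryClassical.TopDegreeExactControl

set_option linter.dupNamespace false

open Literature.NumberTheory.Automorphic Literature.NumberTheory.GaloisRepresentations
open NumberField IsDedekindDomain Filter Polynomial
open scoped BigOperators Classical

/-- **Transport of a cuspidal automorphic induction across a rank identity.**  If for every compactness
proof at rank `1 · [K : F]` there is a cuspidal `P` on `GL_{1·[K:F]}(𝔸_F)` automorphically induced from
`τ` (the output of `automorphicInduction_cyclic_cuspidal` at `n = 1`), then the same holds at any rank
`N = 1 · [K : F]` and any compactness proof `hF` there (a `subst`; the precedent is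
`CuspidalAutomorphicRepData.exists_hasSatakeParamAt_iff_of_eq`). [folklore] -/
theorem exists_cuspidal_along_of_eq {F K : Type} [Field F] [NumberField F] [Field K] [NumberField K]
    [Algebra F K] {hE : isCompact_glFiniteIntegralLevel 1 K}
    (τ : AutomorphicRepData (AutomorphyDatum.gl 1 K hE)) {N : ℕ} (hN : 1 * Module.finrank F K = N)
    (hF : isCompact_glFiniteIntegralLevel N F)
    (h : ∀ hK : isCompact_glFiniteIntegralLevel (1 * Module.finrank F K) F,
      ∃ P : CuspidalAutomorphicRepData (1 * Module.finrank F K) F hK,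
        IsAutomorphicInductionAlong τ P.1) :
    ∃ P : CuspidalAutomorphicRepData N F hF, IsAutomorphicInductionAlong τ P.1 := by
  subst hN
  exact h hF

/-- **An infinity type of rank one whose `a`-multiset at every embedding is a singleton integer is
L-algebraic**: each weight `(a, b)` has `a = -n_ι ∈ ℤ` and `b = a - m ∈ ℤ` (`ArchWeight.exists_int_sub`).
(Buzzard–Gee 2014, Def. 3.1.1.) [cite: BuzzardGee2014, Definition 3.1.1] -/
theorem isLAlgebraic_of_map_a_eq_singleton {K : Type} [Field K] {n : ℕ} {T : InfinityType K n}
    (e : (K →+* ℂ) → ℤ) (hT : ∀ ι : K →+* ℂ, (T ι).map ArchWeight.a = {((e ι : ℤ) : ℂ)}) :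
    T.IsLAlgebraic := by
  intro ι w hw
  have ha : w.a ∈ (T ι).map ArchWeight.a := Multiset.mem_map.mpr ⟨w, hw, rfl⟩
  rw [hT ι, Multiset.mem_singleton] at ha
  obtain ⟨m, hm⟩ := w.exists_int_sub
  refine ⟨e ι, e ι - m, ha, ?_⟩
  push_cast
  linear_combination ha - hm

/-- **Stub `stub_cmInducedCuspidal`** (registered signature, verbatim; line `top-degree-exact-control`,
skeleton rev 6, CM regime, automorphic side).  Cuspidal automorphic induction of a regular algebraic Hecke
character `θ` through a quadratic extension `K/F` of number fields, with its L-algebraicity, modulo the three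
printed facts (A) `automorphicInduction_cyclic_cuspidal` (Arthur–Clozel, Ch. 3 Thm. 6.2 / Lemma 6.4),
(B) `Henniart2012_infinityType_of_automorphicInduction` (Henniart 2012, archimedean components of an
automorphic induction), (C) `AutomorphicRepData.exists_hasInfinityType` (Clozel 1990, §3.3) prepended as
hypotheses: there is a CUSPIDAL `π` on `GL₂(𝔸_F)`, L-algebraic, with Satake polynomial
`∏_{w ∣ v} (X^{f(w|v)} - θ(ϖ_w))` at almost every `v`.  Proof: `π := AI_K^F(π_θ)` from (A) at `n = 1`
(`K/F` is Galois with cyclic group of prime order; `π_θ` is cuspidal and, by the regularity hypothesis, not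
Galois-stable); the Satake clause is Def. 6.1 at `n = 1`; `π_θ` has the integral infinity type of `θ`, so by
(C) and (B) `π` has the induced infinity type, whose exponents are the same integers.
[cite: ArthurClozelAMS120, Ch. 3 Thm. 6.2 and Lemma 6.4] [cite: Henniart2012, §1.10, Thm. 3 (i), Thm. 5]
[cite: Clozel1990, §3.3] [cite: BuzzardGee2014, Definition 3.1.1] -/
theorem stub_cmInducedCuspidal : Literature.NumberTheory.Automorphic.automorphicInduction_cyclic_cuspidal → Literature.NumberTheory.Automorphic.Henniart2012_infinityType_of_automorphicInduction → (∀ (n : ℕ) (K : Type) [Field K] [NumberField K] (hK : Literature.NumberTheory.Automorphic.isCompact_glFiniteIntegralLevel n K) (π : Literature.NumberTheory.Automorphic.AutomorphicRepData (Literature.NumberTheory.Automorphic.AutomorphyDatum.gl n K hK)), π.exists_hasInfinityType) → ∀ (F : Type) [Field F] [NumberField F] (hcpt : Literature.NumberTheory.Automorphic.isCompact_glFiniteIntegralLevel 2 F) (K : Type) [Field K] [NumberField K] [Algebra F K], Module.finrank F K = 2 → ∀ (θ : Literature.NumberTheory.GaloisRepresentations.HeckeCharacter K), θ.IsAlgebraic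 → (∃ᶠ w : IsDedekindDomain.HeightOneSpectrum (NumberField.RingOfIntegers K) in Filter.cofinite, ∃ w' : IsDedekindDomain.HeightOneSpectrum (NumberField.RingOfIntegers K), w'.asIdeal.under (NumberField.RingOfIntegers F) = w.asIdeal.under (NumberField.RingOfIntegers F) ∧ θ.valueAtUniformizer w' ≠ θ.valueAtUniformizer w) → ∃ π : Literature.NumberTheory.Automorphic.CuspidalAutomorphicRepData 2 F hcpt, π.1.IsLAlgebraic ∧ ∀ᶠ v : IsDedekindDomain.HeightOneSpectrum (NumberField.RingOfIntegers F) in Filter.cofinite, ∃ α : Multiset ℂ, π.1.HasSatakeParamAt v α ∧ Literature.NumberTheory.Automorphic.satakePolynomial α = ∏ᶠ w ∈ {w : IsDedekindDomain.HeightOneSpectrum (NumberField.RingOfIntegers K) | w.under (NumberField.RingOfIntegers F) = v}, (Polynomial.X ^ w.asIdeal.inertiaDeg (NumberField.RingOfIntegers F) - Polynomial.C (θ.valueAtUniformizer w)) := by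
  intro hAIc hHen hIT F _ _ hcpt K _ _ _ hK2 θ halg hreg
  -- (1) `K/F` quadratic: Galois, cyclic, of prime degree
  haveI : Algebra.IsQuadraticExtension F K := ⟨hK2⟩
  haveI : Module.Finite F K := Module.Finite.of_restrictScalars_finite ℚ F K
  haveI : Algebra.IsSeparable F K := Algebra.IsSeparable.of_integral F K
  haveI : IsGalois F K := Algebra.IsQuadraticExtension.isGalois F K
  have hcyc : IsCyclic (K ≃ₐ[F] K) := Algebra.IsQuadraticExtension.isCyclic F K
  have hprime : (Module.finrank F K).Prime := by rw [hK2]; exact Nat.prime_two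
  -- (2) the datum `π_θ` of `GL₁(𝔸_K)` and its cuspidal automorphic induction (fact (A) at `n = 1`)
  set hE := isCompact_glFiniteIntegralLevel_holds 1 K
  obtain ⟨τ, hτ⟩ := exists_automorphicRepData_hasSatakeParamAt_valueAtUniformizer hE θ
  have hnst : ¬ IsGaloisStableSatakeAE F τ := not_isGaloisStableSatakeAE_of_frequently_ne θ hτ hreg
  obtain ⟨P, hAI⟩ : ∃ P : CuspidalAutomorphicRepData 2 F hcpt, IsAutomorphicInductionAlong τ P.1 :=
    exists_cuspidal_along_of_eq τ (by rw [hK2]) hcpt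
      fun hK => hAIc 1 F K hcyc hprime one_pos hE hK ⟨τ, τ.W_le_cuspFormsGL_one⟩ hnst
  -- (3) the Satake clause: Def. 6.1 at `n = 1` is the character identity
  have hsat := (isAutomorphicInductionAlong_iff_of_hasSatakeParamAt_singleton θ hτ P.1).1 hAI
  -- (4) L-algebraicity: the integral infinity type of `θ`, induced
  obtain ⟨p, q, hpq⟩ := (HeckeCharacter.isAlgebraic_iff_exists_hasInfinityType θ).mp halg
  have hχ := τ.heckeCharacter_of_eventually_hasSatakeParamAt_glOne hτ
  obtain ⟨Tτ, hTτ, hTa⟩ := τ.exists_hasInfinityType_of_hasInfinityType_heckeCharacter_glOne hχ hpq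
  have hTτL : Tτ.IsLAlgebraic :=
    isLAlgebraic_of_map_a_eq_singleton (fun ι => -HeckeCharacter.embExponent p q ι)
      fun ι => by rw [hTa ι]; push_cast; rfl
  obtain ⟨TP, hTP⟩ := hIT 2 F hcpt P.1
  have hind : P.1.HasInfinityType (Tτ.automorphicInduction F (2 * 1)) :=
    hHen.hasInfinityType_automorphicInduction F K hcyc 1 2 one_pos hK2 hcpt hE P
      ⟨τ, τ.W_le_cuspFormsGL_one⟩ hAI hTP hTτ
  exact ⟨P, ⟨Tτ.automorphicInduction F (2 * 1), hind, hTτL.automorphicInduction⟩, hsat⟩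

end Summit.Langlands.Langlands.Cruxes.ProModularOrdinaryClassical.TopDegreeExactControl

end
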